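import Mathlib.CategoryTheory.Galois.Equivalence
import Mathlib.CategoryTheory.Comma.Over.Basic
import Literature.AnabelianGeometry.Anabelioids.InductionEquivalence
import Literature.AnabelianGeometry.Anabelioids.BasicProofs
import Literature.AnabelianGeometry.Anabelioids.GaloisEquivalence
import HarnessLib

/-!
# Anabelioids: the slice of a connected anabelioid over a connected object is a connected anabelioid

Mochizuki, *Semi-graphs of anabelioids*, Publ. RIMS **42** (2006), §2 p. 23
[cite: MochizukiSemiAnbd2006, Def. 2.2(i) p.23] (with [GeoAn] Rem. 1.2.2.1 p. 17): for a finite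
étale covering `B(𝒢)_{G'} → B(𝒢)` "the constituent anabelioid at a vertex over `v` is the
component anabelioid `(𝒢_v)_P`" — i.e. the slice category `𝒢_v / P` over a connected object `P`
of the connected anabelioid (Galois category) `𝒢_v` is again a connected anabelioid.  Brick B1 of
the existence half of Def. 2.2 (i) (`exists_finiteEtaleCovering`).

* `galoisCategory_over` — for `C` a Galois category and `P` a connected object,
  `GaloisCategory (Over P)`.

Proof: `C ≌ B(Aut F)` (Mathlib's `functorToContAction`, fibre functor switched to the universe
of `Aut F`); the image of `P` is a transitive finite continuous `Aut F`-set, hence `≅ Aut F / U`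
for the (open, finite-index) stabiliser `U` of a point; `Over P ≌ Over (Aut F / U) ≌ B(U)`
(t12's `Induction.fiberEquivalence`, [GeoAn] Rem. 1.2.2.1); `B(U)` is Galois
(`galoisCategory_bCat`); transport back (`galoisCategory_of_equivalence`).  Proof-only.
-/

namespace Literature.AnabelianGeometry.Anabelioids

open CategoryTheory CategoryTheory.Limits CategoryTheory.PreGaloisCategory Topology
open Literature.AlgebraicGeometry.Frobenioids (BCat)
open scoped FintypeCatDiscrete Pointwise

universe u₂ u₁

variable {C : Type u₁} [Category.{u₂} C] [GaloisCategory C]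

/-- **The slice of a connected anabelioid over a connected object is a connected anabelioid**
(`(𝒢_v)_P`, [SemiAnbd] p. 23; [GeoAn] Rem. 1.2.2.1: `B(G)_{G/U} ≌ B(U)`).
[cite: MochizukiSemiAnbd2006, Def. 2.2(i) p.23] -/
theorem galoisCategory_over (P : C) [IsConnected P] : GaloisCategory (Over P) := by
  classical
  -- a fibre functor valued in the universe of `Aut F`
  let F : C ⥤ FintypeCat.{max u₁ u₂} :=
    GaloisCategory.getFiberFunctor C ⋙ FintypeCat.uSwitch.{u₂, max u₁ u₂}
  letI : FiberFunctor F := FiberFunctor.comp_right _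
  let e₁ : C ≌ ContAction FintypeCat.{max u₁ u₂} (Aut F) := (functorToContAction F).asEquivalence
  let X : BCat (Aut F) := (functorToContAction F).obj P
  -- a point of the (nonempty, transitive) fibre and its open stabiliser of finite index
  obtain ⟨x⟩ := (inferInstance : Nonempty (F.obj P))
  let U : Subgroup (Aut F) := MulAction.stabilizer (Aut F) x
  have hU : IsOpen (U : Set (Aut F)) :=
    (isContinuous_iff_stabilizer_isOpen X.obj).mp X.property x
  haveI : Finite (Aut F ⧸ U) :=
    Finite.of_equiv _ (MulAction.orbitEquivQuotientStabilizer (Aut F) x)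
  -- the orbit map `Aut F / U ≅ X`
  have htrans : ∀ y : F.obj P, ∃ g : Aut F, g • x = y := fun y => MulAction.exists_smul_eq (Aut F) x y
  let θ : Aut F ⧸ U → F.obj P := fun q => Quotient.liftOn' q (fun g : Aut F => g • x) fun g g' h => by
    have h' : g⁻¹ * g' ∈ U := QuotientGroup.leftRel_apply.mp h
    have hfix : (g⁻¹ * g') • x = x := MulAction.mem_stabilizer_iff.mp h'
    rw [mul_smul, inv_smul_eq_iff] at hfix
    exact hfix.symm
  have θ_mk : ∀ g : Aut F, θ (g : Aut F ⧸ U) = g • x := fun _ => rfl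
  have θ_bij : Function.Bijective θ := by
    constructor
    · intro q q' hqq'
      obtain ⟨g, rfl⟩ := QuotientGroup.mk_surjective q
      obtain ⟨g', rfl⟩ := QuotientGroup.mk_surjective q'
      rw [θ_mk, θ_mk] at hqq'
      apply QuotientGroup.eq.mpr
      apply MulAction.mem_stabilizer_iff.mpr
      rw [mul_smul, ← hqq', inv_smul_smul]
    · intro y
      obtain ⟨g, hg⟩ := htrans y
      exact ⟨(g : Aut F ⧸ U), hg⟩
  have θ_smul : ∀ (g : Aut F) (q : Aut F ⧸ U), θ (g • q) = g • θ q := by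
    intro g q
    obtain ⟨k, rfl⟩ := QuotientGroup.mk_surjective q
    rw [MulAction.Quotient.smul_coe, smul_eq_mul, θ_mk, θ_mk, mul_smul]
  let eV : (Induction.quotObj U hU).obj.V ≅ X.obj.V :=
    FintypeCat.equivEquivIso (Equiv.ofBijective θ θ_bij)
  let i : Induction.quotObj U hU ≅ X :=
    ObjectProperty.isoMk _ (Action.mkIso eV fun g => by
      apply FintypeCat.hom_ext
      intro (q : Aut F ⧸ U)
      change θ (g • q) = g • θ q
      exact θ_smul g q)
  -- the chain of equivalences
  let e₂ : Over P ≌ Over X := Over.postEquiv P e₁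
  let e₃ : Over X ≌ Over (Induction.quotObj U hU) := Over.mapIso i.symm
  let e₄ : Over (Induction.quotObj U hU) ≌ BCat U := Induction.fiberEquivalence U hU
  haveI : GaloisCategory (BCat U) := galoisCategory_bCat U
  exact galoisCategory_of_equivalence (e₂.trans (e₃.trans e₄)).symm

end Literature.AnabelianGeometry.Anabelioids
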